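import Summits.BirchSwinnertonDyer.BirchSwinnertonDyer.Theorems.GenusKolyvaginAtTwoGenusPrimitiveSupplyAtTwoArchimedeanDescAdmissible
import Summits.BirchSwinnertonDyer.BirchSwinnertonDyer.Theorems.GenusKolyvaginAtTwoGenusPrimitiveSupplyAtTwoArchimedeanFrame
import Summits.BirchSwinnertonDyer.BirchSwinnertonDyer.Theorems.GenusKolyvaginAtTwoGenusPrimitiveSupplyAtTwoTwistRamifiedTransversalRat
import Summits.BirchSwinnertonDyer.BirchSwinnertonDyer.Theorems.GenusKolyvaginAtTwoGenusPrimitiveSupplyAtTwoLocalTwoTorsion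
import Summits.BirchSwinnertonDyer.BirchSwinnertonDyer.Theorems.GenusKolyvaginAtTwoPowDvdShaCardAtTwoRTGenusParity
import Literature.NumberTheory.EllipticCurves.HeegnerHypothesisKroneckerProofs
import Literature.NumberTheory.EllipticCurves.QuadraticTwistKroneckerLFunctionProofs
import HarnessLib

/-!
# Route `GenusKolyvaginAtTwo`, crux #2 `GenusPrimitiveSupplyAtTwo` (stmt-BirchSwinnertonDyer-22136):
# KRAMER'S CONGRUENCE FOR THE TWIST BY A QUADRATIC DISCRIMINANT IN WHICH `2` AND `N` SPLIT — the local indices computed: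
# `d₂(W) + d₂(W^{(d_K)}) ≡ [d_K < 0] (mod 2)` (Monsky 1996, proof of Lemma 1.4(b); Kramer 1981 Thm. 1 + Props. 3, 6 + reciprocity)

Width seat `bsd-line-gk2-p5` g19 (cell `bsd-f1-sign2`, SUPPLY lineage of crux 22136), file 56 of the series. THEOREMS ONLY (no definition,
no named fact, no `sorry`); helper `--supports stmt-BirchSwinnertonDyer-22136`; no item is closed; BSD is not proved by any of this.

WHAT. `W/ℚ` globally minimal elliptic; `K` a quadratic field (`[K:ℚ] = 2`, discriminant `d_K`) in which `2` and every prime of the conductor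
`N_W` split (`SatisfiesHeegnerHypothesis 2 K`, `SatisfiesHeegnerHypothesis N_W K` — the hypotheses of Monsky's Lemma 1.4(b) = the tree's named fact
`Monsky1996_lemma14b_twoSelmerRank_parity`). For the twist `W' = W.quadraticTwist d_K`:

* §1 `isSquare_card_selmerGroup_mul_twist_mul_localIndices` — **Kramer's congruence with the local indices COMPUTED**:
  `#Sel₂(W') · #Sel₂(W) · 2^{[Δ_W > 0 ∧ d_K < 0]} · ∏_{q ∣ d_K} #W(ℚ_q)[2]` is a perfect square. Engine: gk2-p4's framed Kramer congruence
  `GenusKolyKramer.isSquare_card_selmerGroup_mul_of_frame` (Mazur–Rubin Thm. 2.7 via the explicit Poonen–Rains form, no image hypothesis) for the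
  canonical identification `E^{(d_K)}[2] ≅ E[2]` of `exists_intertwining_hsplit_and_transverse_inl_frame`; place menu: `2` and the bad primes
  SPLIT (`d_K ≡ 1 (8)`, `(d_K/ℓ) = 1`: `δ = 0` by Lemma 2.10 (i)), good primes `q ∤ d_K` (`δ = 0`, Lemma 2.10 (v)), the primes `q ∣ d_K` (odd, good:
  TRANSVERSE by Lemma 2.11, so `δ_q = dim 𝓛_q = dim W(ℚ_q)[2]` = Kramer's Prop. 3), the real place (`δ_∞ = [Δ > 0]` if `d_K < 0` by Lemma 2.9 /
  Kramer Prop. 6; split if `d_K > 0`).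
* `jacobiSym_eq_one_of_mod_eight_eq_one` — reciprocity for `m ≡ 1 (8)`: `J(Δ | m) = 1` when every odd prime of `Δ` is a residue of `m` (the
  real-quadratic companion of gk2-p5's `jacobiSym_eq_sign`).

Next file (`…KramerTwistParity`): the sign of the genus budget and `d₂(W) + d₂(W^{(d_K)}) ≡ [d_K < 0] (mod 2)`; then `+` Cassels–Tate + corank
base change ⟹ `Monsky1996_lemma14b_twoSelmerRank_parity_holds`.

References: [Monsky1996] Lemma 1.4(b) and §2; [Kramer1981] Thm. 1, Props. 3, 6, 7, Cor. 1; [MazurRubin2010] Thm. 2.7, Lemmas 2.9–2.11;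
[KlagsbrunMazurRubin2013] Thm. 3.9, Lemma 5.2; [IrelandRosen1990] Prop. 5.2.2.
-/

set_option linter.dupNamespace false -- tree convention: `Summit.BirchSwinnertonDyer.BirchSwinnertonDyer.Theorems` (summit = sub-problem)
set_option autoImplicit false

noncomputable section

open scoped Classical ContRepresentation

namespace Summit.BirchSwinnertonDyer.BirchSwinnertonDyer.Theorems.GenusKolyArch

open WeierstrassCurve Field NumberField IsDedekindDomain Function
open Literature.NumberTheory.EllipticCurves Literature.NumberTheory.GaloisRepresentations
open Literature.NumberTheory.EllipticCurves.DokchitserDokchitser2012 (T xT)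
open Literature.NumberTheory.GaloisRepresentations.DiscreteGaloisModule (SelmerStructure)
open Literature.NumberTheory.GaloisCohomology
open Summit.BirchSwinnertonDyer.Rank1Residual.X11b.CongruentTransfer
open Summit.BirchSwinnertonDyer.BirchSwinnertonDyer.Theorems.GenusKolyTwistLocal
open Rat.HeightOneSpectrum (primesEquiv natGenerator)

/-! ## §2 Reciprocity: `J(Δ | m) = 1` for `m ≡ 1 (mod 8)`; the sign of the genus budget -/

section Reciprocity

/-- **Reciprocity for `m ≡ 1 (mod 8)`.** If every odd prime `p ∣ Δ` (`Δ ≠ 0`) satisfies `J(m | p) = 1`, then `J(Δ | m) = 1`: write `|Δ| = 2^e·a`,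
`a` odd; `J(a | m) = J(m | a) = ∏ J(m | p) = 1` (reciprocity, `m ≡ 1 (4)`), `J(2 | m) = χ₈(m) = 1`, `J(−1 | m) = χ₄(m) = 1`.
[cite: IrelandRosen1990, Prop. 5.2.2] -/
theorem jacobiSym_eq_one_of_mod_eight_eq_one {m : ℕ} (hm8 : m % 8 = 1) {Δ : ℤ} (hΔ : Δ ≠ 0)
    (h1 : ∀ p : ℕ, p.Prime → p ≠ 2 → (p : ℤ) ∣ Δ → jacobiSym (m : ℤ) p = 1) :
    jacobiSym Δ m = 1 := by
  have hm4 : m % 4 = 1 := by omega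
  have hmodd : Odd m := Nat.odd_iff.mpr (by omega)
  obtain ⟨e, a, ha, hea⟩ := Nat.exists_eq_two_pow_mul_odd (Int.natAbs_ne_zero.mpr hΔ)
  have ha0 : a ≠ 0 := by
    rintro rfl
    exact (Nat.not_odd_zero ha).elim
  have hΔeq : Δ = Δ.sign * ((2 : ℤ) ^ e * (a : ℤ)) := by
    conv_lhs => rw [← Int.sign_mul_natAbs Δ, hea]
    push_cast
    ring
  -- `J(a | m) = 1`
  have hJa : jacobiSym (a : ℤ) m = 1 := by
    have hma : jacobiSym (m : ℤ) a = 1 := by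
      refine GenusKolyTwin.jacobiSym_eq_one_of_forall_prime ha0 fun p hp hpa => ?_
      have hp2 : p ≠ 2 := by
        rintro rfl
        exact (Nat.not_even_iff_odd.mpr ha) (even_iff_two_dvd.mpr hpa)
      refine h1 p hp hp2 (Int.ofNat_dvd_left.mpr ?_)
      rw [hea]
      exact Dvd.dvd.mul_left hpa _
    rw [jacobiSym.quadratic_reciprocity_one_mod_four' ha hm4]
    exact hma
  -- `J(2 | m) ^ e = 1`
  have hJ2 : jacobiSym 2 m ^ e = 1 := by
    rw [jacobiSym.at_two hmodd, ZMod.χ₈_nat_eq_if_mod_eight, if_neg (by omega), if_pos (Or.inl hm8), one_pow]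
  -- `J(sign Δ | m) = 1`
  have hJs : jacobiSym Δ.sign m = 1 := by
    rcases lt_or_gt_of_ne hΔ with hneg | hpos
    · rw [Int.sign_eq_neg_one_of_neg hneg, jacobiSym.at_neg_one hmodd, ZMod.χ₄_nat_one_mod_four hm4]
    · rw [Int.sign_eq_one_of_pos hpos, jacobiSym.one_left]
  conv_lhs => rw [hΔeq]
  rw [jacobiSym.mul_left, jacobiSym.mul_left, jacobiSym.pow_left, hJs, hJ2, hJa, mul_one, mul_one]

end Reciprocity

/-! ## §1 Kramer's congruence for the twist by `d_K`, with the local indices computed -/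

section LocalIndices

variable (W : WeierstrassCurve ℚ) [W.IsElliptic] [W.IsGloballyMinimal] (K : Type) [Field K] [NumberField K]

/-- `[K : A ⊓ K] = #K` when `A ⊓ K = ⊥`. [folklore] -/
theorem relIndex_eq_natCard_of_inf_eq_bot {G : Type*} [AddGroup G] {A B : AddSubgroup G} (h : A ⊓ B = ⊥) :
    A.relIndex B = Nat.card B := by
  rw [← AddSubgroup.inf_relIndex_right, h, AddSubgroup.relIndex_bot_left]

omit [W.IsElliptic] [W.IsGloballyMinimal] in
/-- Under `SatisfiesHeegnerHypothesis 2 K` the discriminant is `≡ 1 (mod 8)`, hence odd and not divisible by any prime of the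
conductor under the Heegner hypothesis. [folklore] -/
theorem discr_emod_eight_of_two (h2 : Module.finrank ℚ K = 2) (hH2 : SatisfiesHeegnerHypothesis 2 K) :
    NumberField.discr K % 8 = 1 :=
  Literature.SatisfiesHeegnerHypothesis.discr_emod_eight h2 hH2 (dvd_refl 2)

/-- **The ramified places (Kramer Prop. 3 / Mazur–Rubin Lemma 2.11): `[𝓚_q : 𝓐_q ⊓ 𝓚_q] = #W(ℚ_q)[2] = 1 + #{roots of ψ mod q}`** at a
prime `q ∣ d_K` (odd, of good reduction), for ANY intertwining pair `φ : W'[2] ⇄ W[2] : ψ` and the transported Kummer structure `𝓐 = φ_* 𝓚_{W'}`.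
[cite: Kramer1981, §2 Prop. 3] [cite: MazurRubin2010, Lemma 2.2 (i) and Lemma 2.11] -/
theorem relIndex_transport_inr_eq_card_roots_add_one (h2 : Module.finrank ℚ K = 2) (hH2 : SatisfiesHeegnerHypothesis 2 K)
    (hHN : SatisfiesHeegnerHypothesis (W.conductorNorm ℤ) K)
    {Wd : WeierstrassCurve ℚ} [Wd.IsElliptic] {C : VariableChange ℚ} (hWd : C • W.quadraticTwist (NumberField.discr K : ℚ) = Wd)
    (φ : (Wd.torsionGaloisModule ((2 : ℕ) : ℤ)).toContRepresentation →ⁱL (W.torsionGaloisModule ((2 : ℕ) : ℤ)).toContRepresentation)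
    (ψ : (W.torsionGaloisModule ((2 : ℕ) : ℤ)).toContRepresentation →ⁱL (Wd.torsionGaloisModule ((2 : ℕ) : ℤ)).toContRepresentation)
    (hψφ : ∀ a, ψ (φ a) = a)
    (𝓐 : SelmerStructure (W.torsionGaloisModule ((2 : ℕ) : ℤ)))
    (h𝓐 : ∀ v, 𝓐 v = (Wd.kummerSelmerStructure ((2 : ℕ) : ℤ) v).map
      (galoisCohomology.map (φ.restrictField (Place.Completion v)) 1))
    (v : HeightOneSpectrum (𝓞 ℚ)) (hv : ((primesEquiv v : ℕ)) ∣ (NumberField.discr K).natAbs) :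
    haveI := Fact.mk (primesEquiv v).2
    (𝓐 (Sum.inr v)).relIndex (W.kummerSelmerStructure ((2 : ℕ) : ℤ) (Sum.inr v)) =
      {x : ZMod (primesEquiv v : ℕ) | 4 * x ^ 3 + ((integralModelInt W).b₂ : ZMod (primesEquiv v : ℕ)) * x ^ 2 +
        2 * ((integralModelInt W).b₄ : ZMod (primesEquiv v : ℕ)) * x + ((integralModelInt W).b₆ : ZMod (primesEquiv v : ℕ)) = 0}.ncard + 1 := by
  haveI := Fact.mk (primesEquiv v).2
  set q : ℕ := (primesEquiv v : ℕ) with hq_def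
  have hqP : q.Prime := (primesEquiv v).2
  have hqv : (q : 𝓞 ℚ) ∈ v.asIdeal := Rat.HeightOneSpectrum.natCast_natGenerator_mem v
  set d : ℤ := NumberField.discr K with hd_def
  have h8 : d % 8 = 1 := discr_emod_eight_of_two K h2 hH2
  have hqd : (q : ℤ) ∣ d := Int.natCast_dvd.mpr hv
  have hq2 : q ≠ 2 := by
    rintro h
    rw [h] at hqd
    omega
  have h2v : ((2 : ℕ) : 𝓞 ℚ) ∉ v.asIdeal :=
    GenusKolyTwistingPrime.natCast_not_mem_of_not_dvd hqP hqv fun h ↦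
      hq2 ((Nat.prime_dvd_prime_iff_eq hqP Nat.prime_two).mp h)
  have hqN : ¬ q ∣ W.conductorNorm ℤ := fun h ↦
    Literature.SatisfiesHeegnerHypothesis.not_dvd_discr h2 hHN hqP h hqd
  have hW : W.HasGoodReductionAt v := by
    by_contra h
    exact hqN ((W.dvd_conductorNorm_iff v).mpr h)
  have hqΔ : ¬ (q : ℤ) ∣ minimalDiscriminantInt W :=
    GenusExact.PlusDescent.not_dvd_minimalDiscriminantInt_of_dvd_discr_of_heegner W K h2 hHN hqP hq2 hqd
  -- `q ∥ d_K`
  have hodd : Odd d := Int.odd_iff.mpr (by omega)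
  have hsf : Squarefree d.natAbs := GenusExact.PlusDescent.squarefree_natAbs_discr_of_odd h2 hodd
  have hq2d : ¬ (q : ℤ) ^ 2 ∣ d := by
    intro h
    have h' : q * q ∣ d.natAbs := by
      have h1 := Int.natAbs_dvd_natAbs.mpr h
      rwa [Int.natAbs_pow, Int.natAbs_natCast, sq] at h1
    exact hqP.ne_one (Nat.isUnit_iff.mp (hsf q h'))
  have hdv : v.valuation ℚ (d : ℚ) = WithZero.exp (-1 : ℤ) :=
    valuation_ringOfIntegers_intCast_eq_exp_neg_one v hqd hq2d
  -- transversality (Lemma 2.11) and the count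
  have htr := GenusKolyTwistRamified.map_kummerLocalConditionAt_inf_eq_bot_of_twist_rat W hWd v h2v hW hdv φ ψ hψφ
  have hbot : 𝓐 (Sum.inr v) ⊓ W.kummerSelmerStructure ((2 : ℕ) : ℤ) (Sum.inr v) = ⊥ := by
    rw [h𝓐, kummerSelmerStructure_apply, kummerSelmerStructure_apply]
    exact htr
  rw [relIndex_eq_natCard_of_inf_eq_bot hbot, kummerSelmerStructure_apply]
  change Nat.card (W.kummerLocalConditionAt ((2 : ℕ) : ℤ) (v.adicCompletion ℚ)) = _
  rw [W.natCard_kummerLocalConditionAt_adicCompletion v two_ne_zero, natCard_quot_adicCompletionIntegers_eq_one h2v, mul_one,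
    natCard_ker_nsmul_adicCompletion_eq_padic W v 2, GenusKolyTwin.natCard_twoTorsion_padic_eq W hq2 hqΔ]

omit [W.IsGloballyMinimal] in
/-- **The real place (Kramer Prop. 6 / Mazur–Rubin Lemma 2.9 at `v ∣ ∞`): `[𝓚_∞ : 𝓐_∞ ⊓ 𝓚_∞] = 2^{[Δ_W > 0 ∧ d < 0]}`** for the
canonical identification (`hsplit` at split places, `hreal` at non-split real places with `Δ > 0`) and any twist model of `W^{(d)}`:
`d > 0` ⟹ `√d ∈ ℝ`, the conditions agree; `d < 0`, `Δ < 0` ⟹ `𝓚_∞ = 0`; `d < 0`, `Δ > 0` ⟹ transverse, `#𝓚_∞ = 2`.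
[cite: Kramer1981, §2 Prop. 6 (p. 127)] [cite: MazurRubin2010, Lemma 2.9 and Lemma 2.10 (i)] -/
theorem relIndex_transport_inl_eq {d : ℤ} (hd0 : d ≠ 0) {Wd : WeierstrassCurve ℚ} [Wd.IsElliptic]
    (φ : (Wd.torsionGaloisModule ((2 : ℕ) : ℤ)).toContRepresentation →ⁱL (W.torsionGaloisModule ((2 : ℕ) : ℤ)).toContRepresentation)
    (hsplit : ∀ (E : Type) [Field E] [Algebra ℚ E], (∃ s : E, s ^ 2 = algebraMap ℚ E (d : ℚ)) →
      (Wd.kummerLocalConditionAt ((2 : ℕ) : ℤ) E).map (galoisCohomology.map (φ.restrictField E) 1) =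
        W.kummerLocalConditionAt ((2 : ℕ) : ℤ) E)
    (hreal : ∀ (w : InfinitePlace ℚ) (hw : w.IsReal), 0 < InfinitePlace.embedding_of_isReal hw W.Δ →
      (∀ s : w.Completion, s ^ 2 ≠ algebraMap ℚ w.Completion (d : ℚ)) →
      (Wd.kummerLocalConditionAt ((2 : ℕ) : ℤ) w.Completion).map (galoisCohomology.map (φ.restrictField w.Completion) 1) ⊓
        W.kummerLocalConditionAt ((2 : ℕ) : ℤ) w.Completion = ⊥)
    (𝓐 : SelmerStructure (W.torsionGaloisModule ((2 : ℕ) : ℤ)))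
    (h𝓐 : ∀ v, 𝓐 v = (Wd.kummerSelmerStructure ((2 : ℕ) : ℤ) v).map
      (galoisCohomology.map (φ.restrictField (Place.Completion v)) 1))
    (w : InfinitePlace ℚ) :
    (𝓐 (Sum.inl w)).relIndex (W.kummerSelmerStructure ((2 : ℕ) : ℤ) (Sum.inl w)) = if 0 < W.Δ ∧ d < 0 then 2 else 1 := by
  have hw : w.IsReal := by rw [Subsingleton.elim w Rat.infinitePlace]; exact Rat.isReal_infinitePlace
  have hΔ0 : W.Δ ≠ 0 := W.isUnit_Δ.ne_zero
  rcases lt_or_gt_of_ne hd0 with hdneg | hdpos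
  · have hdneg' : (d : ℚ) < 0 := by exact_mod_cast hdneg
    have hdsq := forall_sq_ne_completion_of_neg hdneg' w
    rcases lt_or_gt_of_ne hΔ0 with hΔ | hΔ
    · -- `Δ < 0`: the archimedean Kummer condition is trivial
      rw [if_neg (fun h ↦ (lt_asymm h.1 hΔ).elim)]
      have h1 : Nat.card (W.kummerSelmerStructure ((2 : ℕ) : ℤ) (Sum.inl w)) = 1 :=
        natCard_kummerSelmerStructure_inl_rat_eq_one_of_Δ_neg W hΔ w
      have hdvd := AddSubgroup.relIndex_dvd_card (𝓐 (Sum.inl w)) (W.kummerSelmerStructure ((2 : ℕ) : ℤ) (Sum.inl w))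
      rw [h1] at hdvd
      exact Nat.dvd_one.mp hdvd
    · -- `Δ > 0`: transverse, `#𝓚_∞ = 2`
      rw [if_pos ⟨hΔ, hdneg⟩]
      have hΔ' : 0 < InfinitePlace.embedding_of_isReal hw W.Δ := by rwa [embedding_of_isReal_rat_apply, Rat.cast_pos]
      have hbot : 𝓐 (Sum.inl w) ⊓ W.kummerSelmerStructure ((2 : ℕ) : ℤ) (Sum.inl w) = ⊥ := by
        rw [h𝓐, kummerSelmerStructure_apply, kummerSelmerStructure_apply]
        exact hreal w hw hΔ' hdsq
      rw [relIndex_eq_natCard_of_inf_eq_bot hbot]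
      exact natCard_kummerSelmerStructure_inl_rat_eq_two_of_Δ_pos W hΔ w
  · -- `d > 0`: the real place splits
    rw [if_neg (fun h ↦ (lt_asymm h.2 hdpos).elim)]
    have hsq : ∃ s : w.Completion, s ^ 2 = algebraMap ℚ w.Completion (d : ℚ) := by
      refine ⟨(InfinitePlace.Completion.ringEquivRealOfIsReal hw).symm (Real.sqrt d), ?_⟩
      apply (InfinitePlace.Completion.ringEquivRealOfIsReal hw).injective
      rw [map_pow, RingEquiv.apply_symm_apply, ringEquivRealOfIsReal_algebraMap hw, embedding_of_isReal_rat_apply,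
        Real.sq_sqrt (by exact_mod_cast hdpos.le)]
      push_cast
      rfl
    have heq : 𝓐 (Sum.inl w) = W.kummerSelmerStructure ((2 : ℕ) : ℤ) (Sum.inl w) := by
      rw [h𝓐, kummerSelmerStructure_apply, kummerSelmerStructure_apply]
      exact hsplit (Place.Completion (Sum.inl w)) hsq
    rw [heq, AddSubgroup.relIndex_self]

/-- **The finite places off `d_K` agree**: at a prime `q ∤ d_K` the transported Kummer condition of the twist model equals that of `W` —
`q = 2` splits (`d_K ≡ 1 (8)` is a `2`-adic square), an odd bad `q` splits (`(d_K/q) = 1`), an odd good `q ∤ d_K` is good for both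
(Mazur–Rubin Lemma 2.10 (i), (v)). [cite: MazurRubin2010, Lemma 2.10] [cite: Serre1973, Ch. II §3.3] -/
theorem transport_inr_eq_of_not_dvd_discr (h2 : Module.finrank ℚ K = 2) (hH2 : SatisfiesHeegnerHypothesis 2 K)
    (hHN : SatisfiesHeegnerHypothesis (W.conductorNorm ℤ) K)
    {Wd : WeierstrassCurve ℚ} [Wd.IsElliptic] {C : VariableChange ℚ} (hWd : C • W.quadraticTwist (NumberField.discr K : ℚ) = Wd)
    (φ : (Wd.torsionGaloisModule ((2 : ℕ) : ℤ)).toContRepresentation →ⁱL (W.torsionGaloisModule ((2 : ℕ) : ℤ)).toContRepresentation)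
    (ψ : (W.torsionGaloisModule ((2 : ℕ) : ℤ)).toContRepresentation →ⁱL (Wd.torsionGaloisModule ((2 : ℕ) : ℤ)).toContRepresentation)
    (hφψ : ∀ b, φ (ψ b) = b)
    (hsplit : ∀ (E : Type) [Field E] [Algebra ℚ E], (∃ s : E, s ^ 2 = algebraMap ℚ E (NumberField.discr K : ℚ)) →
      (Wd.kummerLocalConditionAt ((2 : ℕ) : ℤ) E).map (galoisCohomology.map (φ.restrictField E) 1) =
        W.kummerLocalConditionAt ((2 : ℕ) : ℤ) E)
    (𝓐 : SelmerStructure (W.torsionGaloisModule ((2 : ℕ) : ℤ)))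
    (h𝓐 : ∀ v, 𝓐 v = (Wd.kummerSelmerStructure ((2 : ℕ) : ℤ) v).map
      (galoisCohomology.map (φ.restrictField (Place.Completion v)) 1))
    (v : HeightOneSpectrum (𝓞 ℚ)) (hv : ¬ ((primesEquiv v : ℕ)) ∣ (NumberField.discr K).natAbs) :
    𝓐 (Sum.inr v) = W.kummerSelmerStructure ((2 : ℕ) : ℤ) (Sum.inr v) := by
  haveI := Fact.mk (primesEquiv v).2
  set d : ℤ := NumberField.discr K with hd_def
  have hqP : (primesEquiv v : ℕ).Prime := (primesEquiv v).2
  have hqv : ((primesEquiv v : ℕ) : 𝓞 ℚ) ∈ v.asIdeal := Rat.HeightOneSpectrum.natCast_natGenerator_mem v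
  have h8 : d % 8 = 1 := discr_emod_eight_of_two K h2 hH2
  have hqd : ¬ ((primesEquiv v : ℕ) : ℤ) ∣ d := fun h ↦ hv (Int.natCast_dvd.mp h)
  -- a `q`-adic square gives the split option
  have hsq : IsSquare ((d : ℤ) : ℚ_[(primesEquiv v : ℕ)]) → 𝓐 (Sum.inr v) = W.kummerSelmerStructure ((2 : ℕ) : ℤ) (Sum.inr v) := by
    intro hsq
    have hsq' : IsSquare (((d : ℚ) : ℚ) : ℚ_[(primesEquiv v : ℕ)]) := by
      simpa only [Rat.cast_intCast] using hsq
    obtain ⟨s, hs⟩ := TwoDescentLocal.isSquare_algebraMap_adicCompletion_of_padic v hsq'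
    rw [h𝓐, kummerSelmerStructure_apply, kummerSelmerStructure_apply]
    exact hsplit (Place.Completion (Sum.inr v)) ⟨s, by rw [sq]; exact hs.symm⟩
  by_cases hp2 : (primesEquiv v : ℕ) = 2
  · exact hsq (Literature.NumberTheory.QuadraticForms.padic_isSquare_intCast_of_mod_eight hp2 h8)
  have h2v : ((2 : ℕ) : 𝓞 ℚ) ∉ v.asIdeal :=
    GenusKolyTwistingPrime.natCast_not_mem_of_not_dvd hqP hqv fun h ↦
      hp2 ((Nat.prime_dvd_prime_iff_eq hqP Nat.prime_two).mp h)
  by_cases hpN : (primesEquiv v : ℕ) ∣ W.conductorNorm ℤ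
  · -- an odd bad prime splits
    exact hsq (padic_isSquare_of_jacobiSym_eq_one hp2
      (Literature.SatisfiesHeegnerHypothesis.jacobiSym_discr_eq_one h2 hHN hqP hpN hp2))
  · -- an odd good prime off `d_K`: good for both
    have hW : W.HasGoodReductionAt v := by
      by_contra h
      exact hpN ((W.dvd_conductorNorm_iff v).mpr h)
    have hp2d : ¬ (((primesEquiv v : Nat.Primes) : ℕ) : ℤ) ∣ 2 * d := by
      intro h
      rcases (Nat.prime_iff_prime_int.mp hqP).dvd_or_dvd h with h2' | hd'
      · exact hp2 ((Nat.prime_dvd_prime_iff_eq hqP Nat.prime_two).mp (by exact_mod_cast h2'))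
      · exact hqd hd'
    exact transport_kummer_inr_eq_of_good W Wd 2 φ ψ hφψ 𝓐 h𝓐 h2v hW
      (hasGoodReductionAt_of_smul_quadraticTwist W v hp2d hW hWd)

/-- **KRAMER'S CONGRUENCE FOR THE TWIST BY `d_K`, WITH THE LOCAL INDICES COMPUTED** (Monsky 1996, proof of Lemma 1.4(b); Kramer 1981
Thm. 1 with Props. 3, 6, 7). `W/ℚ` globally minimal elliptic, `K` quadratic with `2` and every prime of `N_W` split: for `W' = W.quadraticTwist d_K`,
`#Sel₂(W') · #Sel₂(W) · (2^{[Δ_W > 0 ∧ d_K < 0]} · ∏_{q ∣ d_K} #W(ℚ_q)[2])` is a perfect square, `#W(ℚ_q)[2] = 1 + #{roots of ψ mod q}`. Proof: the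
framed Kramer congruence (`GenusKolyKramer.isSquare_card_selmerGroup_mul_of_frame`, Mazur–Rubin Thm. 2.7 via Poonen–Rains, no image hypothesis) for
the canonical identification `exists_intertwining_hsplit_and_transverse_inl_frame`, with `S = {∞} ∪ {q ∣ d_K}`: off `S` the conditions agree
(`transport_inr_eq_of_not_dvd_discr`), at `q ∣ d_K` the index is `#W(ℚ_q)[2]` (`relIndex_transport_inr_eq_card_roots_add_one`), at `∞` it is
`2^{[Δ > 0 ∧ d_K < 0]}` (`relIndex_transport_inl_eq`). [cite: Kramer1981, Thm. 1, Props. 3, 6, 7] [cite: Monsky1996, Lemma 1.4(b) and §2]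
[cite: MazurRubin2010, Thm. 2.7, Lemmas 2.9–2.11] -/
theorem isSquare_card_selmerGroup_mul_twist_mul_localIndices (h2 : Module.finrank ℚ K = 2) (hH2 : SatisfiesHeegnerHypothesis 2 K)
    (hHN : SatisfiesHeegnerHypothesis (W.conductorNorm ℤ) K)
    {Wd : WeierstrassCurve ℚ} [Wd.IsElliptic] {C : VariableChange ℚ} (hWd : C • W.quadraticTwist (NumberField.discr K : ℚ) = Wd) :
    IsSquare (Nat.card (Wd.selmerGroup ((2 : ℕ) : ℤ)) * Nat.card (W.selmerGroup ((2 : ℕ) : ℤ)) *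
      ((if 0 < W.Δ ∧ NumberField.discr K < 0 then 2 else 1) *
        ∏ q ∈ (NumberField.discr K).natAbs.primeFactors,
          ({x : ZMod q | 4 * x ^ 3 + ((integralModelInt W).b₂ : ZMod q) * x ^ 2 +
            2 * ((integralModelInt W).b₄ : ZMod q) * x + ((integralModelInt W).b₆ : ZMod q) = 0}.ncard + 1))) := by
  set d : ℤ := NumberField.discr K with hd_def
  have hd0 : d ≠ 0 := NumberField.discr_ne_zero K
  have hd0' : (d : ℚ) ≠ 0 := by exact_mod_cast hd0
  -- the canonical identification with its frame datum
  obtain ⟨φ, ψ, hψφ, hφψ, hsplit, hreal, π, A, hπ, hA⟩ := exists_intertwining_hsplit_and_transverse_inl_frame W hd0' hWd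
  have hφinj : Function.Injective φ := fun a b h ↦ by rw [← hψφ a, ← hψφ b, h]
  -- the transported structure
  let 𝓐 : SelmerStructure (W.torsionGaloisModule ((2 : ℕ) : ℤ)) := fun v ↦
    (Wd.kummerSelmerStructure ((2 : ℕ) : ℤ) v).map (galoisCohomology.map (φ.restrictField (Place.Completion v)) 1)
  have h𝓐 : ∀ v, 𝓐 v = (Wd.kummerSelmerStructure ((2 : ℕ) : ℤ) v).map
      (galoisCohomology.map (φ.restrictField (Place.Completion v)) 1) := fun _ ↦ rfl
  -- the exceptional set `S = {∞} ∪ {q ∣ d_K}`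
  set winf : InfinitePlace ℚ := Rat.infinitePlace with hwinf
  let emb : {q // q ∈ d.natAbs.primeFactors} → HeightOneSpectrum (𝓞 ℚ) := fun q ↦
    primesEquiv.symm ⟨q.1, (Nat.mem_primeFactors.mp q.2).1⟩
  have hemb_inj : Function.Injective emb := by
    intro a b h
    have h' := congrArg (fun v ↦ ((primesEquiv v : Nat.Primes) : ℕ)) h
    simp only [emb, Equiv.apply_symm_apply] at h'
    exact Subtype.ext h'
  have hemb_val : ∀ q, ((primesEquiv (emb q) : Nat.Primes) : ℕ) = q.1 := fun q ↦ by
    simp only [emb, Equiv.apply_symm_apply]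
  set T : Finset (HeightOneSpectrum (𝓞 ℚ)) := d.natAbs.primeFactors.attach.image emb with hT
  have hTmem : ∀ v, v ∈ T ↔ ((primesEquiv v : Nat.Primes) : ℕ) ∣ d.natAbs := by
    intro v
    constructor
    · rintro hv
      obtain ⟨q, -, rfl⟩ := Finset.mem_image.mp hv
      rw [hemb_val]
      exact (Nat.mem_primeFactors.mp q.2).2.1
    · intro hv
      refine Finset.mem_image.mpr ⟨⟨(primesEquiv v : ℕ), Nat.mem_primeFactors.mpr ⟨(primesEquiv v).2, hv,
        Int.natAbs_ne_zero.mpr hd0⟩⟩, Finset.mem_attach _ _, ?_⟩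
      apply primesEquiv.injective
      simp only [emb, Equiv.apply_symm_apply]
      rfl
  set S : Finset (Place ℚ) := insert (Sum.inl winf) (T.map ⟨Sum.inr, Sum.inr_injective⟩) with hS_def
  have hS : ∀ v ∉ S, 𝓐 v = W.kummerSelmerStructure ((2 : ℕ) : ℤ) v := by
    rintro (w | v) hv
    · exact absurd (by rw [hS_def, Subsingleton.elim w winf]; exact Finset.mem_insert_self _ _) hv
    · have hvT : v ∉ T := fun h ↦ hv (by
        rw [hS_def, Finset.mem_insert]
        exact Or.inr (Finset.mem_map.mpr ⟨v, h, rfl⟩))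
      exact transport_inr_eq_of_not_dvd_discr W K h2 hH2 hHN hWd φ ψ hφψ hsplit 𝓐 h𝓐 v ((hTmem v).not.mp hvT)
  -- Kramer's congruence for the framed identification
  have hK := GenusKolyKramer.isSquare_card_selmerGroup_mul_of_frame W Wd φ hφinj π hπ A hA 𝓐 h𝓐 S hS
  -- evaluate the local indices over `S`
  have hprod : ∏ v ∈ S, (𝓐 v).relIndex (W.kummerSelmerStructure ((2 : ℕ) : ℤ) v) =
      (if 0 < W.Δ ∧ d < 0 then 2 else 1) *
        ∏ q ∈ d.natAbs.primeFactors,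
          ({x : ZMod q | 4 * x ^ 3 + ((integralModelInt W).b₂ : ZMod q) * x ^ 2 +
            2 * ((integralModelInt W).b₄ : ZMod q) * x + ((integralModelInt W).b₆ : ZMod q) = 0}.ncard + 1) := by
    have hnot : Sum.inl winf ∉ T.map ⟨Sum.inr, Sum.inr_injective⟩ := by
      intro h
      obtain ⟨v, -, hv⟩ := Finset.mem_map.mp h
      exact Sum.inr_ne_inl hv
    rw [hS_def, Finset.prod_insert hnot, Finset.prod_map, relIndex_transport_inl_eq W hd0 φ hsplit hreal 𝓐 h𝓐 winf]
    congr 1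
    rw [hT, Finset.prod_image (fun a _ b _ h ↦ hemb_inj h)]
    rw [← Finset.prod_attach d.natAbs.primeFactors]
    refine Finset.prod_congr rfl fun q _ ↦ ?_
    have hrel := relIndex_transport_inr_eq_card_roots_add_one W K h2 hH2 hHN hWd φ ψ hψφ 𝓐 h𝓐 (emb q)
      (by rw [hemb_val]; exact (Nat.mem_primeFactors.mp q.2).2.1)
    simp only [Function.Embedding.coeFn_mk] at hrel ⊢
    rw [hrel]
    -- transport the root count along `primesEquiv (emb q) = q`
    have key : ∀ n m : ℕ, n = m →
        ({x : ZMod n | 4 * x ^ 3 + ((integralModelInt W).b₂ : ZMod n) * x ^ 2 +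
            2 * ((integralModelInt W).b₄ : ZMod n) * x + ((integralModelInt W).b₆ : ZMod n) = 0}.ncard + 1) =
          ({x : ZMod m | 4 * x ^ 3 + ((integralModelInt W).b₂ : ZMod m) * x ^ 2 +
            2 * ((integralModelInt W).b₄ : ZMod m) * x + ((integralModelInt W).b₆ : ZMod m) = 0}.ncard + 1) := by
      rintro n m rfl; rfl
    exact key _ _ (hemb_val q)
  rw [hprod] at hK
  exact hK

end LocalIndices

end Summit.BirchSwinnertonDyer.BirchSwinnertonDyer.Theorems.GenusKolyArch

end
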